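import Literature.NumberTheory.Automorphic.WeightedHilbertSchmidtVanishing
import Literature.NumberTheory.Automorphic.HilbertRepTraceComparison
import Literature.NumberTheory.Automorphic.HilbertRepSpectrumProofs
import HarnessLib

/-!
# Proof of `WeightedHilbertSchmidtVanishing` (Labesse–Langlands, Lemma 6.1 mechanism = Rogawski, Prop. 13.8.1)

Topic `NumberTheory/Automorphic`; theorems only.  DISCHARGES the named fact ★ `WeightedHilbertSchmidtVanishing` (node A1 of
the statement tree of [Rogawski1990, Prop. 13.8.1] = [LabesseLanglands1979, Lemma 6.1]): `weightedHilbertSchmidtVanishing_holds`.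

THE PROOF (isotypic disjointness — shorter than print and valid for the abstract text, which carries NO uniform operator
bound `sup_i ‖f i‖ < ∞`, so that print's `δ = max λ(π)` and the eigenvector of `π₀(f f^*)` are unavailable).  Data: pairwise
inequivalent irreducible unitary `π i` on Hilbert spaces `E i`; a subspace `B` of simultaneous operator families stable under
`f ↦ (π_i(g) f_i)_i` and non-degenerate; Hilbert bases `b i`; real weights with `Σ_i l_i ‖f_i‖²_{HS} = 0` (absolutely
convergent) on `B`, `‖f_i‖²_{HS} = Σ_k ‖f_i (b i k)‖²`.
1. On the Hilbert sum `H := ℓ²((i,k); E i)` (Mathlib `lp (fun p : Σ i, κ i => E p.1) 2`) the COLUMN MAPS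
   `J⁺ f := (√(l i) · f_i (b i k))_{(i,k)}`, `J⁻ f := (√(−l i) · f_i (b i k))_{(i,k)}` (`√` of a negative number is `0`) have
   `‖J⁺ f‖² = Σ_i max(l_i,0) ‖f_i‖²_{HS}`, `‖J⁻ f‖² = Σ_i max(−l_i,0) ‖f_i‖²_{HS}`; the hypothesis AT `f` ITSELF is print's (6.1)
   `Σ_{l>0} l tr π(f f^*) = Σ_{l<0} (−l) tr π(f f^*)`, i.e. `‖J⁺ f‖ = ‖J⁻ f‖`.
2. Hence (★ `exists_extension_comp_eq_of_norm_le`, the engine of Jacquet–Langlands' «simple remark», p. 498) a bounded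
   `Ψ : H → H` with `Ψ ∘ J⁺ = J⁻` commuting with the unitary diagonals `D_g := ⊕ π_i(g)` (`B` is stable under
   `f ↦ (π_i(g) f_i)_i`, and `D_g^* = D_{g⁻¹}` preserves the closure of the range of `J⁺`).
3. Every block `E i → E j` of `Ψ` (coordinate embedding, `Ψ`, coordinate evaluation) intertwines `π i`, `π j`; for `i ≠ j` it is
   `0` by Schur's lemma for inequivalent irreducible unitary representations (`eq_zero_of_not_areUnitarilyEquivalent` below).
4. For `f ∈ B` and `l j < 0` the `(j,m)`-coordinate of `J⁻ f = Ψ (J⁺ f)` is `Σ_{(i,k)} block_{(j,m),(i,k)} ((J⁺ f)_{(i,k)})`, each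
   term `0` (`l_i ≤ 0` kills the coordinate, `l_i > 0 > l_j` the block): `√(−l_j) f_j (b j m) = 0` for all `m`, so `f_j = 0` for
   EVERY `f ∈ B`, contradicting non-degeneracy.  No weight is negative; with `−l`, none is positive: `l = 0`.
«Closed under products ∕ adjoints», «`ι` countable» and the `ℝ≥0∞` finiteness of the named fact are carried, not needed
(`forall_weight_nonneg_…`, `forall_weight_eq_zero_…` are the hypothesis-minimal forms).
HONEST LABEL: this proves the abstract named fact A1 only; HC_CM is proved only modulo the printed citations until rung 0 closes.

## References
* J.-P. Labesse, R. P. Langlands, *L-indistinguishability for SL(2)*, Canad. J. Math. 31 (1979), Lemma 6.1, proof pp. 768–769.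
* H. Jacquet, R. P. Langlands, *Automorphic Forms on GL(2)*, LNM 114 (1970), §16, Lemma 16.1.1, proof p. 498.
* J. D. Rogawski, *Automorphic Representations of Unitary Groups in Three Variables*, Ann. of Math. Stud. 123 (1990), 13.8.1 p. 206.
* A. Deitmar, S. Echterhoff, *Principles of Harmonic Analysis*, 2nd ed. (2014), Lemma 6.1.7, Cor. 6.1.9.
-/

set_option autoImplicit false

noncomputable section

open scoped InnerProductSpace ENNReal NNReal

/-! ### Schur's lemma for two inequivalent irreducible unitary representations -/

namespace ContRepresentation

variable {G : Type*} [Group G]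
  {E : Type*} [NormedAddCommGroup E] [InnerProductSpace ℂ E] [CompleteSpace E]
  {E' : Type*} [NormedAddCommGroup E'] [InnerProductSpace ℂ E'] [CompleteSpace E']

/-- **Schur's lemma, two-representation form**: a bounded intertwiner between topologically irreducible unitary
representations which are NOT unitarily equivalent is zero (★ `exists_norm_map_eq_mul`: `‖T v‖ = r ‖v‖`; if `r ≠ 0`,
`r⁻¹ T` is an isometric intertwiner onto a closed invariant non-zero subspace, i.e. onto `E'` — a unitary equivalence).
[cite: DeitmarEchterhoff2014, Cor. 6.1.9] -/
theorem IsTopIrreducible.eq_zero_of_not_areUnitarilyEquivalent {ρ₁ : ContRepresentation ℂ G E}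
    {ρ₂ : ContRepresentation ℂ G E'} (h₁ : ρ₁.IsTopIrreducible) (hu₁ : ρ₁.IsUnitary)
    (h₂ : ρ₂.IsTopIrreducible) (hu₂ : ρ₂.IsUnitary) (hne : ¬ AreUnitarilyEquivalent ρ₁ ρ₂)
    {T : E →L[ℂ] E'} (hT : ∀ g : G, T ∘L ρ₁ g = ρ₂ g ∘L T) : T = 0 := by
  obtain ⟨r, hr0, hr⟩ := h₁.exists_norm_map_eq_mul hu₁ hu₂ hT
  rcases hr0.eq_or_lt with h0 | hpos
  · ext v
    rw [zero_apply, ← norm_eq_zero, hr v, ← h0, zero_mul]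
  · exfalso -- `U = r⁻¹ • T` is an isometric intertwiner
    have hnormU : ∀ v : E, ‖((r⁻¹ : ℝ) : ℂ) • T v‖ = ‖v‖ := fun v => by
      rw [norm_smul, Complex.norm_real, Real.norm_eq_abs, abs_of_pos (inv_pos.2 hpos), hr v,
        inv_mul_cancel_left₀ hpos.ne']
    let U : E →ₗᵢ[ℂ] E' :=
      { toLinearMap := ((r⁻¹ : ℝ) : ℂ) • (T : E →ₗ[ℂ] E')
        norm_map' := fun v => by rw [LinearMap.smul_apply, ContinuousLinearMap.coe_coe]; exact hnormU v }
    have hUapply : ∀ v : E, U v = ((r⁻¹ : ℝ) : ℂ) • T v := fun v => rfl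
    have hU : ∀ (g : G) (v : E), U (ρ₁ g v) = ρ₂ g (U v) := fun g v => by
      rw [hUapply, hUapply, map_smul, ← ContinuousLinearMap.comp_apply, hT g,
        ContinuousLinearMap.comp_apply]
    rcases ((isTopIrreducible_iff ρ₂).1 h₂).2 (ClosedSubrep.ofLinearIsometry U hU) with hbot | htop
    · haveI : Nontrivial E := ((isTopIrreducible_iff ρ₁).1 h₁).1
      obtain ⟨v, hv⟩ := exists_ne (0 : E)
      have hmem : U v ∈ ClosedSubrep.ofLinearIsometry U hU := (ClosedSubrep.mem_ofLinearIsometry U hU _).2 ⟨v, rfl⟩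
      rw [hbot, ClosedSubrep.mem_bot] at hmem
      exact hv (norm_eq_zero.1 ((U.norm_map v).symm.trans (by rw [hmem, norm_zero])))
    · have hsurj : Function.Surjective U := fun w =>
        (ClosedSubrep.mem_ofLinearIsometry U hU w).1 (by rw [htop]; exact ClosedSubrep.mem_top w)
      let e : E ≃ₗᵢ[ℂ] E' := LinearIsometryEquiv.ofSurjective U hsurj
      refine hne ⟨Equiv.mk e.toContinuousLinearEquiv fun g => ?_, fun v w => e.isometry v w⟩
      ext v
      exact hU g v

end ContRepresentation

namespace Literature.NumberTheory.Automorphic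

/-! ### The Hilbert sum `ℓ²(a; F a)` of a family of Hilbert spaces: diagonal operators, column maps -/

section Ell2Family

variable {α : Type*} {F : α → Type*} [∀ a, NormedAddCommGroup (F a)]

/-- `‖v‖² = Σ_a ‖v a‖²` in the Hilbert sum `ℓ²(a; F a)`. [cite: JacquetLanglands1970, §16, Lemma 16.1.1 (proof) p. 498] -/
theorem lp_two_hasSum_norm_sq_family (v : lp F 2) : HasSum (fun a => ‖v a‖ ^ 2) (‖v‖ ^ 2) := by
  have h := lp.hasSum_norm (by norm_num : 0 < (2 : ℝ≥0∞).toReal) v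
  simp only [ENNReal.toReal_ofNat, Real.rpow_two] at h
  exact h

/-- A family with `Σ_a ‖v a‖² < ∞` lies in `ℓ²(a; F a)`. [cite: JacquetLanglands1970, §16, Lemma 16.1.1 (proof) p. 498] -/
theorem memℓp_two_of_summable_norm_sq {v : ∀ a, F a} (h : Summable fun a => ‖v a‖ ^ 2) :
    Memℓp v 2 := by
  refine memℓp_gen ?_
  simpa only [ENNReal.toReal_ofNat, Real.rpow_two] using h

variable [∀ a, InnerProductSpace ℂ (F a)]

/-- **Diagonal operators on the Hilbert sum of a family**: uniformly bounded operators `A a` (`‖A a x‖ ≤ C ‖x‖`) act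
coordinatewise as a bounded operator of `ℓ²(a; F a)`. [cite: JacquetLanglands1970, §16, Lemma 16.1.1 (proof) p. 498] -/
theorem lp_two_exists_diagonal_family (A : ∀ a, F a →L[ℂ] F a) {C : ℝ} (hC : 0 ≤ C)
    (hA : ∀ (a : α) (x : F a), ‖A a x‖ ≤ C * ‖x‖) :
    ∃ D : lp F 2 →L[ℂ] lp F 2, ∀ (v : lp F 2) (a : α), D v a = A a (v a) := by
  have hle : ∀ (v : lp F 2) (a : α), ‖A a (v a)‖ ^ 2 ≤ C ^ 2 * ‖v a‖ ^ 2 := fun v a => by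
    rw [← mul_pow]
    exact pow_le_pow_left₀ (norm_nonneg _) (hA a _) 2
  have hmem : ∀ v : lp F 2, Memℓp (fun a => A a (v a)) 2 := fun v =>
    memℓp_two_of_summable_norm_sq (Summable.of_nonneg_of_le (fun a => sq_nonneg _) (hle v)
      ((lp_two_hasSum_norm_sq_family v).summable.mul_left (C ^ 2)))
  let Dₗ : lp F 2 →ₗ[ℂ] lp F 2 :=
    { toFun := fun v => ⟨fun a => A a (v a), hmem v⟩
      map_add' := fun v w => by
        ext a
        simp only [lp.coeFn_add, Pi.add_apply, map_add]
      map_smul' := fun c v => by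
        ext a
        simp only [lp.coeFn_smul, Pi.smul_apply, map_smul, RingHom.id_apply] }
  refine ⟨Dₗ.mkContinuous C fun v => ?_, fun v a => rfl⟩
  refine (sq_le_sq₀ (norm_nonneg _) (by positivity)).1 ?_
  rw [mul_pow]
  exact hasSum_le (hle v) (lp_two_hasSum_norm_sq_family (Dₗ v)) ((lp_two_hasSum_norm_sq_family v).mul_left _)

/-- The adjoint of a diagonal operator is the diagonal of the adjoints. [cite: JacquetLanglands1970, §16, p. 498] -/
theorem lp_two_adjoint_diagonal_family [∀ a, CompleteSpace (F a)] {A : ∀ a, F a →L[ℂ] F a}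
    {D D' : lp F 2 →L[ℂ] lp F 2} (hD : ∀ (v : lp F 2) (a : α), D v a = A a (v a))
    (hD' : ∀ (v : lp F 2) (a : α), D' v a = ContinuousLinearMap.adjoint (A a) (v a)) :
    ContinuousLinearMap.adjoint D = D' := by
  symm
  rw [ContinuousLinearMap.eq_adjoint_iff]
  intro v w
  rw [lp.inner_eq_tsum, lp.inner_eq_tsum]
  exact tsum_congr fun a => by rw [hD', hD, ContinuousLinearMap.adjoint_inner_left]

/-- A diagonal operator on a coordinate vector: `diag(A) (δ_a x) = δ_a (A a x)`. [cite: JacquetLanglands1970, §16, p. 498] -/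
theorem lp_two_diagonal_family_single [DecidableEq α] {A : ∀ a, F a →L[ℂ] F a}
    {D : lp F 2 →L[ℂ] lp F 2} (hD : ∀ (v : lp F 2) (a : α), D v a = A a (v a)) (a : α) (x : F a) :
    D (lp.single 2 a x) = lp.single 2 a (A a x) := by
  ext c
  rw [hD]
  by_cases hc : c = a
  · subst hc
    rw [lp.single_apply_self, lp.single_apply_self]
  · rw [lp.single_apply_ne 2 a x hc, lp.single_apply_ne 2 a (A a x) hc, map_zero]

/-- Mathlib's `lp.evalCLM` at a coordinate is evaluation there. [cite: JacquetLanglands1970, §16, p. 498] -/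
theorem lp_evalCLM_two_apply (a : α) (v : lp F 2) : lp.evalCLM ℂ F 2 a v = v a := rfl

end Ell2Family

section Columns

variable {ι : Type*} {E : ι → Type*} [∀ i, NormedAddCommGroup (E i)] [∀ i, InnerProductSpace ℂ (E i)]

/-- **The column map** `f ↦ (f_i (x i k))_{(i,k)}` from a subspace `B` of simultaneous operator families to the Hilbert sum
`ℓ²((i,k); E i)`, given `Σ_{(i,k)} ‖f_i (x i k)‖² < ∞` on `B` (the map `f ↦ (π(f) x_α)_α` of Jacquet–Langlands, p. 498).
[cite: JacquetLanglands1970, §16, Lemma 16.1.1 (proof) p. 498] -/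
theorem exists_columnMap (B : Submodule ℂ (∀ i, E i →L[ℂ] E i)) {κ : ι → Type*} (x : ∀ i, κ i → E i)
    (hx : ∀ f ∈ B, Summable fun p : (Σ i, κ i) => ‖f p.1 (x p.1 p.2)‖ ^ 2) :
    ∃ J : B →ₗ[ℂ] lp (fun p : (Σ i, κ i) => E p.1) 2,
      ∀ (f : B) (p : Σ i, κ i), J f p = (f : ∀ i, E i →L[ℂ] E i) p.1 (x p.1 p.2) := by
  refine ⟨{ toFun := fun f => ⟨fun p => (f : ∀ i, E i →L[ℂ] E i) p.1 (x p.1 p.2),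
              memℓp_two_of_summable_norm_sq (hx f f.2)⟩
            map_add' := fun f h => by
              ext p
              simp only [Submodule.coe_add, Pi.add_apply, add_apply, lp.coeFn_add]
            map_smul' := fun c f => by
              ext p
              simp only [Submodule.coe_smul, Pi.smul_apply, smul_apply, lp.coeFn_smul,
                RingHom.id_apply] }, fun f p => rfl⟩

/-- `‖√c • y‖² = max(c, 0) ‖y‖²` (`√c = 0` for `c ≤ 0`). [cite: LabesseLanglands1979, Lemma 6.1 (proof) pp. 768–769] -/
theorem norm_sqrt_real_smul_sq {V : Type*} [NormedAddCommGroup V] [NormedSpace ℂ V] (c : ℝ) (y : V) :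
    ‖((Real.sqrt c : ℝ) : ℂ) • y‖ ^ 2 = max c 0 * ‖y‖ ^ 2 := by
  rw [norm_smul, Complex.norm_real, Real.norm_eq_abs, abs_of_nonneg (Real.sqrt_nonneg c), mul_pow,
    Real.sq_sqrt']

end Columns

/-! ### The theorem -/

section Main

variable {G : Type*} [Group G] {ι : Type*} {E : ι → Type*}
  [∀ i, NormedAddCommGroup (E i)] [∀ i, InnerProductSpace ℂ (E i)] [∀ i, CompleteSpace (E i)]

/-- **No weight is negative** ([LabesseLanglands1979, Lemma 6.1]: «all we need do is show that `X⁻` is empty»),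
hypothesis-minimal form: pairwise inequivalent irreducible unitary `π i`; `B` a subspace of simultaneous operator families
stable under `f ↦ (π_i(g) f_i)_i` and non-degenerate; Hilbert bases `b i` along which every `f_i` (`f ∈ B`) is Hilbert–Schmidt;
real weights `l` with `Σ_i l_i ‖f_i‖²_{HS}` summable and `= 0` on `B`.  Then `0 ≤ l i` for all `i` (steps 1–4 of the module
docstring). [cite: LabesseLanglands1979, Lemma 6.1 (proof) pp. 768–769] [cite: JacquetLanglands1970, §16, Lemma 16.1.1 (proof) p. 498] -/
theorem forall_weight_nonneg_of_tsum_weighted_hilbertSchmidt_eq_zero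
    (π : ∀ i, ContRepresentation ℂ G (E i)) (hu : ∀ i, (π i).IsUnitary)
    (hirr : ∀ i, (π i).IsTopIrreducible)
    (hne : ∀ i j, i ≠ j → ¬ ContRepresentation.AreUnitarilyEquivalent (π i) (π j))
    (B : Submodule ℂ (∀ i, E i →L[ℂ] E i))
    (hG : ∀ g : G, ∀ f ∈ B, (fun i => π i g * f i) ∈ B) (hnd : ∀ i, ∃ f ∈ B, f i ≠ 0)
    {κ : ι → Type*} (b : ∀ i, HilbertBasis (κ i) ℂ (E i))
    (hHS : ∀ f ∈ B, ∀ i, Summable fun k => ‖f i (b i k)‖ ^ 2) (l : ι → ℝ)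
    (hl : ∀ f ∈ B, Summable (fun i => l i * ∑' k, ‖f i (b i k)‖ ^ 2) ∧
      ∑' i, l i * ∑' k, ‖f i (b i k)‖ ^ 2 = 0) :
    ∀ i, 0 ≤ l i := by
  classical
  intro j
  by_contra hj
  rw [not_le] at hj
  obtain ⟨f₀, hf₀B, hf₀j⟩ := hnd j
  apply hf₀j
  /- Hilbert–Schmidt sums and the positive / negative parts of the weights -/
  obtain ⟨S, hS⟩ : ∃ S : (∀ i, E i →L[ℂ] E i) → ι → ℝ, ∀ f i, S f i = ∑' k, ‖f i (b i k)‖ ^ 2 :=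
    ⟨_, fun _ _ => rfl⟩
  have hl' : ∀ f ∈ B, Summable (fun i => l i * S f i) ∧ ∑' i, l i * S f i = 0 := fun f hf => by
    simpa only [hS] using hl f hf
  have hS0 : ∀ f i, 0 ≤ S f i := fun f i => by rw [hS]; exact tsum_nonneg fun k => sq_nonneg _
  have hsm : ∀ c : ι → ℝ, (∀ i, c i ≤ |l i|) → ∀ f ∈ B, Summable fun i => max (c i) 0 * S f i :=
    fun c hc f hf => Summable.of_nonneg_of_le (fun i => mul_nonneg (le_max_right _ _) (hS0 f i))
      (fun i => by
        rw [abs_mul, abs_of_nonneg (hS0 f i)]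
        exact mul_le_mul_of_nonneg_right (max_le (hc i) (abs_nonneg _)) (hS0 f i)) (hl' f hf).1.abs
  have hsu := hsm l fun i => le_abs_self _
  have hsw := hsm (fun i => -l i) fun i => neg_le_abs _
  -- print's (6.1): `Σ_{l>0} l_i ‖f_i‖² = Σ_{l<0} (−l_i) ‖f_i‖²`
  have hid : ∀ f ∈ B, ∑' i, max (l i) 0 * S f i = ∑' i, max (-l i) 0 * S f i := fun f hf => by
    have h := (hsu f hf).tsum_sub (hsw f hf)
    have h2 : (fun i => max (l i) 0 * S f i - max (-l i) 0 * S f i) = fun i => l i * S f i :=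
      funext fun i => by rw [← sub_mul, max_zero_sub_max_neg_zero_eq_self]
    rw [h2, (hl' f hf).2] at h
    linarith
  /- the two column maps `J⁺` (weights `√(l i)`) and `J⁻` (weights `√(−l i)`) into `ℓ²((i,k); E i)` -/
  have hcol : ∀ (c : ι → ℝ), (∀ f ∈ B, Summable fun i => max (c i) 0 * S f i) →
      ∀ f ∈ B, Summable fun p : (Σ i, κ i) =>
        ‖f p.1 ((fun i k => ((Real.sqrt (c i) : ℝ) : ℂ) • b i k) p.1 p.2)‖ ^ 2 := by
    intro c hc f hf
    have hrw : (fun p : (Σ i, κ i) => ‖f p.1 ((fun i k => ((Real.sqrt (c i) : ℝ) : ℂ) • b i k) p.1 p.2)‖ ^ 2) =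
        fun p => max (c p.1) 0 * ‖f p.1 (b p.1 p.2)‖ ^ 2 :=
      funext fun p => by simp only [map_smul, norm_sqrt_real_smul_sq]
    have hF : ∀ i, Summable fun k => max (c i) 0 * ‖f i (b i k)‖ ^ 2 := fun i => (hHS f hf i).mul_left _
    have hF' : (fun i => ∑' k, (fun p : (Σ i, κ i) => max (c p.1) 0 * ‖f p.1 (b p.1 p.2)‖ ^ 2) ⟨i, k⟩) =
        fun i => max (c i) 0 * S f i := funext fun i => by rw [hS, ← tsum_mul_left]
    rw [hrw]
    refine (summable_sigma_of_nonneg (f := fun p : (Σ i, κ i) => max (c p.1) 0 * ‖f p.1 (b p.1 p.2)‖ ^ 2)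
      fun p => mul_nonneg (le_max_right _ _) (sq_nonneg _)).2 ⟨fun i => hF i, ?_⟩
    rw [hF']
    exact hc f hf
  obtain ⟨Ju, hJu⟩ := exists_columnMap B (fun i k => ((Real.sqrt (l i) : ℝ) : ℂ) • b i k)
    (hcol l hsu)
  obtain ⟨Jw, hJw⟩ := exists_columnMap B (fun i k => ((Real.sqrt (-l i) : ℝ) : ℂ) • b i k)
    (hcol (fun i => -l i) hsw)
  -- their norms
  have hnorm : ∀ (c : ι → ℝ) (J : B →ₗ[ℂ] lp (fun p : (Σ i, κ i) => E p.1) 2),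
      (∀ (f : B) (p : Σ i, κ i), J f p = (f : ∀ i, E i →L[ℂ] E i) p.1
        ((fun i k => ((Real.sqrt (c i) : ℝ) : ℂ) • b i k) p.1 p.2)) →
      ∀ f : B, ‖J f‖ ^ 2 = ∑' i, max (c i) 0 * S f i := by
    intro c J hJ f
    have hrw : (fun p : (Σ i, κ i) => ‖J f p‖ ^ 2) =
        fun p => max (c p.1) 0 * ‖(f : ∀ i, E i →L[ℂ] E i) p.1 (b p.1 p.2)‖ ^ 2 :=
      funext fun p => by rw [hJ]; simp only [map_smul, norm_sqrt_real_smul_sq]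
    have h1 := lp_two_hasSum_norm_sq_family (J f)
    rw [hrw] at h1
    have hfib : ∀ i, HasSum (fun k => max (c i) 0 * ‖(f : ∀ i, E i →L[ℂ] E i) i (b i k)‖ ^ 2)
        (max (c i) 0 * S f i) := fun i => by
      rw [hS]
      exact (hHS f f.2 i).hasSum.mul_left (max (c i) 0)
    exact (h1.sigma fun i => hfib i).tsum_eq.symm
  have hC : ∀ f : B, ‖Jw f‖ ≤ 1 * ‖Ju f‖ := fun f => by
    have h : ‖Jw f‖ ^ 2 = ‖Ju f‖ ^ 2 := by
      rw [hnorm l Ju hJu f, hnorm (fun i => -l i) Jw hJw f]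
      exact (hid f f.2).symm
    rw [one_mul]
    exact le_of_eq ((sq_eq_sq₀ (norm_nonneg _) (norm_nonneg _)).1 h)
  /- the bounded operator `Ψ` with `Ψ ∘ J⁺ = J⁻` -/
  obtain ⟨Ψ, hΨJ, -, hΨcomm⟩ := exists_extension_comp_eq_of_norm_le Ju Jw 1 hC
  /- the unitary diagonal operators `D g = ⊕_{(i,k)} π_i(g)` -/
  have hDex : ∀ g : G, ∃ D : lp (fun p : (Σ i, κ i) => E p.1) 2 →L[ℂ] lp (fun p : (Σ i, κ i) => E p.1) 2,
      ∀ (v : lp (fun p : (Σ i, κ i) => E p.1) 2) (p : Σ i, κ i), D v p = π p.1 g (v p) := fun g =>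
    lp_two_exists_diagonal_family (F := fun p : (Σ i, κ i) => E p.1) (fun p => π p.1 g) zero_le_one
      fun p x => by rw [one_mul, (hu p.1).norm_map]
  choose D hD using hDex
  -- `Ψ` commutes with them
  have hΨD : ∀ g : G, Ψ ∘L D g = D g ∘L Ψ := by
    intro g
    let a : B → B := fun f => ⟨fun i => π i g * (f : ∀ i, E i →L[ℂ] E i) i, hG g f f.2⟩
    let a' : B → B := fun f => ⟨fun i => π i g⁻¹ * (f : ∀ i, E i →L[ℂ] E i) i, hG g⁻¹ f f.2⟩
    have h1' : ∀ f : B, D g⁻¹ (Ju f) = Ju (a' f) := fun f => lp.ext (funext fun p => by rw [hD, hJu, hJu]; rfl)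
    refine hΨcomm (D g) (D g) a (fun f => lp.ext (funext fun p => by rw [hD, hJu, hJu]; rfl))
      (fun f => lp.ext (funext fun p => by rw [hD, hJw, hJw]; rfl)) ?_
    -- `(D g)^* = D g⁻¹` preserves the closure of the range of `J⁺`
    have hadj : ContinuousLinearMap.adjoint (D g) = D g⁻¹ :=
      lp_two_adjoint_diagonal_family (hD g) fun v p => by rw [hD, (hu p.1).adjoint_apply]
    rw [hadj]
    intro v hv
    rw [← SetLike.mem_coe, Submodule.topologicalClosure_coe] at hv ⊢
    refine map_mem_closure (D g⁻¹).continuous hv fun w hw => ?_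
    obtain ⟨f, rfl⟩ := LinearMap.mem_range.1 hw
    rw [SetLike.mem_coe, h1' f]
    exact LinearMap.mem_range_self Ju (a' f)
  /- Schur: the blocks `E i → E i'` of `Ψ` with `i ≠ i'` vanish -/
  have hblock : ∀ (p q : Σ i, κ i), p.1 ≠ q.1 → ∀ x : E p.1,
      Ψ (lp.single (E := fun r : (Σ i, κ i) => E r.1) 2 p x) q = 0 := by
    intro p q hpq x
    have hT : ∀ g : G,
        (lp.evalCLM ℂ (fun r : (Σ i, κ i) => E r.1) 2 q ∘L Ψ ∘L
            lp.singleContinuousLinearMap ℂ (fun r : (Σ i, κ i) => E r.1) 2 p) ∘L π p.1 g =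
          π q.1 g ∘L (lp.evalCLM ℂ (fun r : (Σ i, κ i) => E r.1) 2 q ∘L Ψ ∘L
            lp.singleContinuousLinearMap ℂ (fun r : (Σ i, κ i) => E r.1) 2 p) := by
      intro g
      ext y
      simp only [ContinuousLinearMap.comp_apply, lp.singleContinuousLinearMap_apply, lp_evalCLM_two_apply]
      rw [← lp_two_diagonal_family_single (hD g) p y, ← ContinuousLinearMap.comp_apply Ψ (D g),
        hΨD g, ContinuousLinearMap.comp_apply, hD]
    have h0 := (hirr p.1).eq_zero_of_not_areUnitarilyEquivalent (hu p.1) (hirr q.1) (hu q.1)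
      (hne p.1 q.1 hpq) hT
    simpa only [ContinuousLinearMap.comp_apply, lp.singleContinuousLinearMap_apply, lp_evalCLM_two_apply,
      zero_apply] using congrArg (fun T : E p.1 →L[ℂ] E q.1 => T x) h0
  /- hence the `(j, m)`-coordinates of `J⁻ f = Ψ (J⁺ f)` vanish for `l j < 0` -/
  have hJw0 : ∀ (f : B) (m : κ j), Jw f ⟨j, m⟩ = 0 := by
    intro f m
    rw [← hΨJ f]
    have hsum : HasSum (fun p : (Σ i, κ i) =>
        Ψ (lp.single (E := fun r : (Σ i, κ i) => E r.1) 2 p (Ju f p)) ⟨j, m⟩) (Ψ (Ju f) ⟨j, m⟩) := by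
      have h1 := Ψ.hasSum (lp.hasSum_single ENNReal.ofNat_ne_top (Ju f))
      exact (lp.evalCLM ℂ (fun r : (Σ i, κ i) => E r.1) 2 ⟨j, m⟩).hasSum h1
    have hzero : ∀ p : (Σ i, κ i),
        Ψ (lp.single (E := fun r : (Σ i, κ i) => E r.1) 2 p (Ju f p)) ⟨j, m⟩ = 0 := by
      intro p
      by_cases hp : 0 < l p.1
      · exact hblock p ⟨j, m⟩ (fun h => lt_asymm hj (show 0 < l (⟨j, m⟩ : Σ i, κ i).1 from h ▸ hp)) _
      · have hJ0 : Ju f p = 0 := by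
          rw [hJu, Real.sqrt_eq_zero'.2 (not_lt.1 hp), Complex.ofReal_zero, zero_smul, map_zero]
        rw [hJ0, lp.single_zero, map_zero]
        rfl
    rw [← hsum.tsum_eq]
    exact (tsum_congr hzero).trans tsum_zero
  /- so `f₀ j` kills the Hilbert basis `b j`, i.e. `f₀ j = 0` -/
  have hcoef : ((Real.sqrt (-l j) : ℝ) : ℂ) ≠ 0 := by exact_mod_cast Real.sqrt_ne_zero'.2 (neg_pos.2 hj)
  refine ContinuousLinearMap.ext_on
    (Submodule.dense_iff_topologicalClosure_eq_top.2 (b j).dense_span) ?_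
  rintro _ ⟨m, rfl⟩
  have h := hJw0 ⟨f₀, hf₀B⟩ m
  rw [hJw] at h
  change f₀ j (((Real.sqrt (-l j) : ℝ) : ℂ) • b j m) = 0 at h
  rw [map_smul, smul_eq_zero] at h
  exact (h.resolve_left hcoef).trans (zero_apply _).symm

/-- **All weights vanish** (hypothesis-minimal form of ★ `WeightedHilbertSchmidtVanishing`: no «closed under products ∕
adjoints», no countability, no uniform operator bound) — the previous theorem for `l` and for `−l`.
[cite: LabesseLanglands1979, Lemma 6.1 (proof) pp. 768–769] [cite: Rogawski1990, Prop. 13.8.1 p. 206] -/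
theorem forall_weight_eq_zero_of_tsum_weighted_hilbertSchmidt_eq_zero
    (π : ∀ i, ContRepresentation ℂ G (E i)) (hu : ∀ i, (π i).IsUnitary)
    (hirr : ∀ i, (π i).IsTopIrreducible)
    (hne : ∀ i j, i ≠ j → ¬ ContRepresentation.AreUnitarilyEquivalent (π i) (π j))
    (B : Submodule ℂ (∀ i, E i →L[ℂ] E i))
    (hG : ∀ g : G, ∀ f ∈ B, (fun i => π i g * f i) ∈ B) (hnd : ∀ i, ∃ f ∈ B, f i ≠ 0)
    {κ : ι → Type*} (b : ∀ i, HilbertBasis (κ i) ℂ (E i))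
    (hHS : ∀ f ∈ B, ∀ i, Summable fun k => ‖f i (b i k)‖ ^ 2) (l : ι → ℝ)
    (hl : ∀ f ∈ B, Summable (fun i => l i * ∑' k, ‖f i (b i k)‖ ^ 2) ∧
      ∑' i, l i * ∑' k, ‖f i (b i k)‖ ^ 2 = 0) :
    ∀ i, l i = 0 := by
  intro i
  have h1 := forall_weight_nonneg_of_tsum_weighted_hilbertSchmidt_eq_zero π hu hirr hne B hG hnd b hHS l hl i
  have h2 : 0 ≤ -l i := forall_weight_nonneg_of_tsum_weighted_hilbertSchmidt_eq_zero π hu hirr hne B hG hnd b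
    hHS (fun i => -l i) (fun f hf => ⟨by simpa only [neg_mul] using (hl f hf).1.neg,
      by rw [show (fun i => -l i * ∑' k, ‖f i (b i k)‖ ^ 2) = fun i => -(l i * ∑' k, ‖f i (b i k)‖ ^ 2) from
        funext fun i => neg_mul _ _, tsum_neg, (hl f hf).2, neg_zero]⟩) i
  linarith

/-- **DISCHARGE of the named fact** ★ `WeightedHilbertSchmidtVanishing` (Labesse–Langlands' Lemma 6.1 mechanism = Rogawski's
Prop. 13.8.1, abstract Hilbert form), from `forall_weight_eq_zero_of_tsum_weighted_hilbertSchmidt_eq_zero` (the `ℝ≥0∞`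
Hilbert–Schmidt finiteness gives the real summability of `k ↦ ‖f_i (b i k)‖²`; products ∕ adjoints ∕ countability unused).
[cite: LabesseLanglands1979, Lemma 6.1 (proof) pp. 768–769] [cite: Rogawski1990, Prop. 13.8.1 p. 206] -/
theorem weightedHilbertSchmidtVanishing_holds : WeightedHilbertSchmidtVanishing := by
  intro G _ ι _ E _ _ _ π hu hirr hne B _ _ hG hnd κ b hHS l hl
  refine forall_weight_eq_zero_of_tsum_weighted_hilbertSchmidt_eq_zero π hu hirr hne B hG hnd b
    (fun f hf i => ?_) l hl
  have hs : Summable fun k => ‖f i (b i k)‖₊ ^ 2 := by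
    rw [← ENNReal.tsum_coe_ne_top_iff_summable]
    simpa only [ENNReal.coe_pow] using (hHS f hf i).ne
  simpa only [NNReal.coe_pow, coe_nnnorm] using NNReal.summable_coe.2 hs

end Main

end Literature.NumberTheory.Automorphic

end
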